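import Literature.Geometry.Lorentzian.SpacetimeChartDeviationTransfer
import Literature.Geometry.Lorentzian.CausalFutureProofs
import HarnessLib

/-!
# Scalar products through charts, and continuity of coordinate images of vector fields
(topic `Geometry/Lorentzian`; elementary bridges between tangent vectors of a spacetime and their
coordinate images in a preferred chart, used by the time-orientation clause of the diagonal datum
for pointed `Cᵏ_loc` convergence, `SpacetimeLocalConvergenceTimeOrientation.lean`)

* `exists_finset_isCompact_pieces` — in a locally compact space a compact set subordinate to an
  open cover is covered by finitely many compact pieces, each inside one member of the cover.
* `mfderiv_chartAt_symm_mfderiv_chartAt` (`d(c⁻¹) ∘ d(c) = id` on the chart source),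
  `metricInCoords_chartAt_symm_apply_mfderiv` (`(c⁻¹)^* g` on coordinate images is `g`),
  `metricInCoords_comp_chartAt_symm_apply_mfderiv` (`(G ∘ c⁻¹)^* g'` on coordinate images is
  `g'(dG ·, dG ·)`), and the **deviation bound** `abs_val_mfderiv_sub_val_le`:
  `|g'(dG u, dG u') − g(u, u')| ≤ ‖chartDeviation G (c z)‖ · ‖d(c) u‖ · ‖d(c) u'‖` — the `C⁰` part of
  the chart deviation controls pulled-back scalar products (O'Neill 1983, Ch. 3, Def. 3.9).
* `chartTime_eq_mfderiv` (the orienting field read in a chart is `d(c)(T)`), and continuity along a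
  `C^∞` map `F` of the coordinate images `d(c' ∘ F)(T_𝓤)` (`continuousOn_mfderiv_chartAt_comp_vectorField`,
  via the continuity of the tangent map), of `chartTime ∘ F`, of `c' ∘ F` and of the metric
  components along `c' ∘ F`.

## References
* [ONeill1983] B. O'Neill, *Semi-Riemannian Geometry*, Academic Press 1983, Ch. 3, Def. 3.9.
* [Petersen2006] P. Petersen, *Riemannian Geometry*, 2nd ed., GTM 171, Springer 2006, Ch. 10, §3.2.
-/

noncomputable section

open TopologicalSpace Manifold Filter Topology Set Function Metric Bundle
open scoped ContDiff Topology ENNReal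

universe u v w

namespace Literature.Geometry.Lorentzian

/-! ### Compact pieces subordinate to an open cover (locally compact Hausdorff spaces) -/

section Pieces

/-- In a locally compact Hausdorff space, a compact set covered by open sets `O a` is covered by
finitely many compact pieces each contained in a single `O a`. [folklore] -/
theorem exists_finset_isCompact_pieces {X : Type*} [TopologicalSpace X] [LocallyCompactSpace X]
    {K : Set X} (hK : IsCompact K) {A : Type*} (O : A → Set X) (hO : ∀ a, IsOpen (O a))
    (hcov : K ⊆ ⋃ a, O a) :
    ∃ (S : Finset X) (N : X → Set X),
      (∀ y ∈ S, IsCompact (N y) ∧ ∃ a, N y ⊆ O a) ∧ K ⊆ ⋃ y ∈ S, N y := by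
  classical
  have hchoice : ∀ y ∈ K, ∃ N : Set X, N ∈ 𝓝 y ∧ IsCompact N ∧ ∃ a, N ⊆ O a := by
    intro y hy
    obtain ⟨a, ha⟩ := mem_iUnion.1 (hcov hy)
    obtain ⟨N, hN, hNO, hNc⟩ := local_compact_nhds ((hO a).mem_nhds ha)
    exact ⟨N, hN, hNc, a, hNO⟩
  choose! N hN hNc hNO using hchoice
  obtain ⟨S, hS⟩ := hK.elim_nhds_subcover' (fun y _ ↦ N y) fun y hy ↦ hN y hy
  refine ⟨S.image Subtype.val, N, fun y hy ↦ ?_, fun p hp ↦ ?_⟩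
  · obtain ⟨y', hy', rfl⟩ := Finset.mem_image.1 hy
    exact ⟨hNc _ y'.2, hNO _ y'.2⟩
  · obtain ⟨y', hy', hpy⟩ := mem_iUnion₂.1 (hS hp)
    exact mem_iUnion₂.2 ⟨(y' : X), Finset.mem_image_of_mem _ hy', hpy⟩

end Pieces

namespace Spacetime

/-! ### Metric values through a chart of the source -/

section Bridge

variable (𝓣 : Spacetime.{v} 4)

/-- `d(c'⁻¹) ∘ d(c') = id` on the chart source: `d(c'.symm)_{c' z} (d(c')_z u) = u`. [folklore] -/
theorem mfderiv_chartAt_symm_mfderiv_chartAt {x₀ z : 𝓣.carrier} (hz : z ∈ (chartAt E4 x₀).source)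
    (u : TangentSpace (𝓡 4) z) :
    mfderiv 𝓘(ℝ, E4) (𝓡 4) (chartAt E4 x₀).symm (chartAt E4 x₀ z)
        (mfderiv (𝓡 4) 𝓘(ℝ, E4) (chartAt E4 x₀) z u) = u := by
  have h := (mdifferentiable_chart (I := 𝓡 4) x₀).symm_comp_deriv hz
  exact congrArg (fun L : TangentSpace (𝓡 4) z →L[ℝ] TangentSpace (𝓡 4) z ↦ L u) h

/-- **Metric values read in a chart**: for `z` in the chart source at `x₀` and tangent vectors
`u, u'` at `z` with coordinate images `d(c')_z u`, `d(c')_z u'`,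
`(c'⁻¹)^* g` evaluated on the images is `g_z(u, u')`. [folklore] -/
theorem metricInCoords_chartAt_symm_apply_mfderiv {x₀ z : 𝓣.carrier}
    (hz : z ∈ (chartAt E4 x₀).source) (u u' : TangentSpace (𝓡 4) z) :
    𝓣.metricInCoords (chartAt E4 x₀).symm (chartAt E4 x₀ z)
        (mfderiv (𝓡 4) 𝓘(ℝ, E4) (chartAt E4 x₀) z u)
        (mfderiv (𝓡 4) 𝓘(ℝ, E4) (chartAt E4 x₀) z u') = 𝓣.metric.val z u u' := by
  rw [metricInCoords_apply, 𝓣.mfderiv_chartAt_symm_mfderiv_chartAt hz,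
    𝓣.mfderiv_chartAt_symm_mfderiv_chartAt hz, (chartAt E4 x₀).left_inv hz]

/-- **Pulled-back metric values read in a chart of the source**: for `G : 𝓣 → 𝓢` differentiable
at `z`, `((G ∘ c'⁻¹)^* g_𝓢)` evaluated on the coordinate images of `u, u'` is
`g_𝓢(dG u, dG u')`. [folklore] -/
theorem metricInCoords_comp_chartAt_symm_apply_mfderiv {𝓢 : Spacetime.{u} 4} {x₀ z : 𝓣.carrier}
    (hz : z ∈ (chartAt E4 x₀).source) {G : 𝓣.carrier → 𝓢.carrier}
    (hG : MDifferentiableAt (𝓡 4) (𝓡 4) G z) (u u' : TangentSpace (𝓡 4) z) :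
    𝓢.metricInCoords (G ∘ (chartAt E4 x₀).symm) (chartAt E4 x₀ z)
        (mfderiv (𝓡 4) 𝓘(ℝ, E4) (chartAt E4 x₀) z u)
        (mfderiv (𝓡 4) 𝓘(ℝ, E4) (chartAt E4 x₀) z u') =
      𝓢.metric.val (G z) (mfderiv (𝓡 4) (𝓡 4) G z u) (mfderiv (𝓡 4) (𝓡 4) G z u') := by
  have hsymm : MDifferentiableAt 𝓘(ℝ, E4) (𝓡 4) (chartAt E4 x₀).symm (chartAt E4 x₀ z) :=
    mdifferentiableAt_atlas_symm (chart_mem_atlas E4 x₀) ((chartAt E4 x₀).map_source hz)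
  have hG' : MDifferentiableAt (𝓡 4) (𝓡 4) G ((chartAt E4 x₀).symm (chartAt E4 x₀ z)) := by
    rw [(chartAt E4 x₀).left_inv hz]; exact hG
  have e1 : (G ∘ (chartAt E4 x₀).symm) (chartAt E4 x₀ z) = G z := by
    rw [comp_apply, (chartAt E4 x₀).left_inv hz]
  have e2 : ∀ w : TangentSpace (𝓡 4) z,
      (mfderiv 𝓘(ℝ, E4) (𝓡 4) (G ∘ (chartAt E4 x₀).symm) (chartAt E4 x₀ z)
        (mfderiv (𝓡 4) 𝓘(ℝ, E4) (chartAt E4 x₀) z w) : E4) =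
        (mfderiv (𝓡 4) (𝓡 4) G z w : E4) := by
    intro w
    rw [mfderiv_comp _ hG' hsymm]
    show (mfderiv (𝓡 4) (𝓡 4) G ((chartAt E4 x₀).symm (chartAt E4 x₀ z))
      (mfderiv 𝓘(ℝ, E4) (𝓡 4) (chartAt E4 x₀).symm (chartAt E4 x₀ z)
        (mfderiv (𝓡 4) 𝓘(ℝ, E4) (chartAt E4 x₀) z w)) : E4) = _
    rw [𝓣.mfderiv_chartAt_symm_mfderiv_chartAt hz, (chartAt E4 x₀).left_inv hz]
  have key : ∀ (P Q : 𝓢.carrier), P = Q → ∀ (a a' : TangentSpace (𝓡 4) P)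
      (b b' : TangentSpace (𝓡 4) Q), (a : E4) = b → (a' : E4) = b' →
      𝓢.metric.val P a a' = 𝓢.metric.val Q b b' := by
    rintro P Q rfl a a' b b' rfl rfl
    rfl
  rw [metricInCoords_apply]
  exact key _ _ e1 _ _ _ _ (e2 u) (e2 u')

/-- **The deviation controls pulled-back scalar products**: with `dev = (G ∘ c'⁻¹)^* g_𝓢 − (c'⁻¹)^* g_𝓣`
the chart deviation of `G` at `x₀`,
`|g_𝓢(dG u, dG u') − g_𝓣(u, u')| ≤ ‖dev(c' z)‖ · ‖d(c') u‖ · ‖d(c') u'‖`. [folklore] -/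
theorem abs_val_mfderiv_sub_val_le {𝓢 : Spacetime.{u} 4} {x₀ z : 𝓣.carrier}
    (hz : z ∈ (chartAt E4 x₀).source) {G : 𝓣.carrier → 𝓢.carrier}
    (hG : MDifferentiableAt (𝓡 4) (𝓡 4) G z) (u u' : TangentSpace (𝓡 4) z) {V V' : E4}
    (hV : V = mfderiv (𝓡 4) 𝓘(ℝ, E4) (chartAt E4 x₀) z u)
    (hV' : V' = mfderiv (𝓡 4) 𝓘(ℝ, E4) (chartAt E4 x₀) z u') :
    |𝓢.metric.val (G z) (mfderiv (𝓡 4) (𝓡 4) G z u) (mfderiv (𝓡 4) (𝓡 4) G z u') -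
        𝓣.metric.val z u u'| ≤
      ‖chartDeviation 𝓢 G x₀ (chartAt E4 x₀ z)‖ * ‖V‖ * ‖V'‖ := by
  have hval : chartDeviation 𝓢 G x₀ (chartAt E4 x₀ z) V V' =
      𝓢.metric.val (G z) (mfderiv (𝓡 4) (𝓡 4) G z u) (mfderiv (𝓡 4) (𝓡 4) G z u') -
        𝓣.metric.val z u u' := by
    rw [hV, hV', chartDeviation_apply, sub_apply, sub_apply,
      𝓣.metricInCoords_comp_chartAt_symm_apply_mfderiv hz hG,
      𝓣.metricInCoords_chartAt_symm_apply_mfderiv hz]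
  rw [← hval, ← Real.norm_eq_abs]
  exact ContinuousLinearMap.le_opNorm₂ _ _ _

end Bridge

/-! ### Coordinate images of the two vector fields along `F`, and their continuity -/

section Coord

variable {𝓤 : Spacetime.{w} 4} {𝓣 : Spacetime.{v} 4}

/-- The chart expression of the orienting field: `chartTime x₀ z = d(c')_z (T z)` on the chart
source (`TangentBundle.continuousLinearMapAt_trivializationAt`). [folklore] -/
theorem chartTime_eq_mfderiv (𝓣 : Spacetime.{v} 4) {x₀ z : 𝓣.carrier}
    (hz : z ∈ (chartAt E4 x₀).source) :
    𝓣.timeOrientation.chartTime x₀ z =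
      mfderiv (𝓡 4) 𝓘(ℝ, E4) (chartAt E4 x₀) z (𝓣.timeOrientation.vectorField z) := by
  rw [𝓣.timeOrientation.chartTime_apply hz, TangentBundle.continuousLinearMapAt_trivializationAt hz]
  have hfun : (extChartAt (𝓡 4) x₀ : 𝓣.carrier → E4) = chartAt E4 x₀ := by
    funext y; simp
  rw [hfun]
  rfl

/-- **Continuity of the coordinate image of `dF(T_𝓤)`**: on the open set
`O' = O ∩ F⁻¹(c'.source)` where `F` is `C^∞`, `x ↦ d(c' ∘ F)_x (T_𝓤 x) ∈ E4` is continuous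
(the tangent map of `c' ∘ F` is continuous, composed with the continuous section `T_𝓤`).
[folklore] -/
theorem continuousOn_mfderiv_chartAt_comp_vectorField {F : 𝓤.carrier → 𝓣.carrier}
    {O : Set 𝓤.carrier} (hO : IsOpen O) (hF : ContMDiffOn (𝓡 4) (𝓡 4) ∞ F O)
    (x₀ : 𝓣.carrier) :
    ContinuousOn (fun x ↦ mfderiv (𝓡 4) 𝓘(ℝ, E4) (chartAt E4 x₀ ∘ F) x
      (𝓤.timeOrientation.vectorField x)) (O ∩ F ⁻¹' (chartAt E4 x₀).source) := by
  set O' : Set 𝓤.carrier := O ∩ F ⁻¹' (chartAt E4 x₀).source with hO'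
  have hO'o : IsOpen O' := hF.continuousOn.isOpen_inter_preimage hO (chartAt E4 x₀).open_source
  set ψ : 𝓤.carrier → E4 := chartAt E4 x₀ ∘ F with hψ
  have hψ' : ContMDiffOn (𝓡 4) 𝓘(ℝ, E4) ∞ ψ O' :=
    (contMDiffOn_chart (x := x₀)).comp (hF.mono inter_subset_left) fun x hx ↦ hx.2
  have htan : ContinuousOn (tangentMapWithin (𝓡 4) 𝓘(ℝ, E4) ψ O')
      (π E4 (TangentSpace (𝓡 4)) ⁻¹' O') :=
    hψ'.continuousOn_tangentMapWithin (by exact_mod_cast le_top) hO'o.uniqueMDiffOn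
  set σ : 𝓤.carrier → TangentBundle (𝓡 4) 𝓤.carrier :=
    fun x ↦ ⟨x, 𝓤.timeOrientation.vectorField x⟩ with hσ
  have hσc : Continuous σ := 𝓤.timeOrientation.contMDiff.continuous
  have hmaps : MapsTo σ O' (π E4 (TangentSpace (𝓡 4)) ⁻¹' O') := fun x hx ↦ hx
  have h1 : ContinuousOn (fun x ↦ tangentMapWithin (𝓡 4) 𝓘(ℝ, E4) ψ O' (σ x)) O' :=
    htan.comp hσc.continuousOn hmaps
  have h2 : ContinuousOn (fun x ↦ (TotalSpace.toProd E4 E4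
      (tangentMapWithin (𝓡 4) 𝓘(ℝ, E4) ψ O' (σ x))).2) O' := by
    have hc : Continuous (fun q : TangentBundle 𝓘(ℝ, E4) E4 ↦ (TotalSpace.toProd E4 E4 q).2) := by
      have h := (tangentBundleModelSpaceHomeomorph 𝓘(ℝ, E4) (H := E4)).continuous
      rw [tangentBundleModelSpaceHomeomorph_coe] at h
      exact continuous_snd.comp h
    exact hc.comp_continuousOn h1
  refine h2.congr fun x hx ↦ ?_
  show mfderiv (𝓡 4) 𝓘(ℝ, E4) ψ x (𝓤.timeOrientation.vectorField x) =
    mfderivWithin (𝓡 4) 𝓘(ℝ, E4) ψ O' x (𝓤.timeOrientation.vectorField x)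
  rw [mfderivWithin_of_isOpen hO'o hx]

/-- Continuity of the chart expression of the orienting field of `𝓣` along `F`. [folklore] -/
theorem continuousOn_chartTime_comp {F : 𝓤.carrier → 𝓣.carrier} {O : Set 𝓤.carrier}
    (hF : ContinuousOn F O) (x₀ : 𝓣.carrier) :
    ContinuousOn (fun x ↦ 𝓣.timeOrientation.chartTime x₀ (F x))
      (O ∩ F ⁻¹' (chartAt E4 x₀).source) :=
  (𝓣.timeOrientation.contMDiffOn_chartTime (by exact_mod_cast le_top) x₀).continuousOn.comp
    (hF.mono inter_subset_left) fun _ hx ↦ hx.2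

/-- Continuity of the chart point `c'(F x)`. [folklore] -/
theorem continuousOn_chartAt_comp {F : 𝓤.carrier → 𝓣.carrier} {O : Set 𝓤.carrier}
    (hF : ContinuousOn F O) (x₀ : 𝓣.carrier) :
    ContinuousOn (fun x ↦ chartAt E4 x₀ (F x)) (O ∩ F ⁻¹' (chartAt E4 x₀).source) :=
  (chartAt E4 x₀).continuousOn.comp (hF.mono inter_subset_left) fun _ hx ↦ hx.2

/-- Continuity of the metric components of `𝓣` in the chart at `x₀`, along `c' ∘ F`. [folklore] -/
theorem continuousOn_metricInCoords_comp {F : 𝓤.carrier → 𝓣.carrier} {O : Set 𝓤.carrier}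
    (hF : ContinuousOn F O) (x₀ : 𝓣.carrier) :
    ContinuousOn (fun x ↦ 𝓣.metricInCoords (chartAt E4 x₀).symm (chartAt E4 x₀ (F x)))
      (O ∩ F ⁻¹' (chartAt E4 x₀).source) :=
  (𝓣.contDiffOn_metricInCoords_chartAt_symm x₀).continuousOn.comp (continuousOn_chartAt_comp hF x₀)
    fun _ hx ↦ (chartAt E4 x₀).map_source hx.2

end Coord

end Spacetime

end Literature.Geometry.Lorentzian
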